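import Summits.FinalStateConjecture.FinalStateConjecture.Theses.ZeroEnergyKerrOrBomb
import Literature.Geometry.Lorentzian.TrappedZeroEnergyRay
import Literature.Geometry.Lorentzian.ZeroEnergyRayTrappedModFlow
import Literature.Geometry.Lorentzian.KillingHorizonShadowAlong
import Literature.Geometry.Lorentzian.Causality

/-!
# Sketch (crux-ideate, crux `KerrOrBomb` = stmt-FinalStateConjecture-10689, round 1, ideator 1)

First lemmas of the two idea cards filed by this seat, stated over tree vocabulary only.

* `AffineRayIsFutureEndless` — card `typed-crux-docks-on-siblings`: the one un-vendored brick
  (`hEnd` of `Theorems/ErgoregionBomb/Negative/TrappingClauseVacuous.lean`) under which the typed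
  `KerrOrBomb` is literally `KerrOrBombOfCruxes ZeroEnergyRigidity ErgoregionBomb`.
* `PhantomHorizonDichotomy` — card `phantom-horizons-have-surface-gravity`: the compact-Cauchy-
  horizon dichotomy (Hawking–Larsson–Minguzzi / Hounnonkpe–Minguzzi 2025 / Petersen–Rácz 2018,
  Petersen 2021) transplanted to a `T`-invariant null sheet of the d.o.c. which is compact modulo
  the stationary flow: either a Killing field null on the sheet exists near it (non-degenerate:
  the sheet is a Killing horizon, absorbed by rigidity) or every generator is a complete null
  geodesic (degenerate = isochronous zero-energy trapping, the bomb's input).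
* `phantomSheet_subset_ergoregion` — sanity: such a sheet lies in the closed ergoregion (proved).
-/

noncomputable section

namespace Summit.FinalStateConjecture.FinalStateConjecture.Cruxes.KerrOrBomb.SketchIdeator1

open Literature.Geometry.Lorentzian
open scoped Manifold Topology
open Set Filter

set_option linter.dupNamespace false

/-- **Card `typed-crux-docks-on-siblings`, first lemma (= `hEnd`).** An affinely parametrised
geodesic of the Levi-Civita connection of `𝓑` on `[0, ∞)` with nowhere-vanishing velocity has no
future endpoint (O'Neill 1983, Ch. 5, Lemma 8: a non-constant geodesic cannot converge as its affine
parameter tends to `∞` — in a chart, `|γ̈| ≤ C|γ̇|²` makes the coordinate length of `γ|[S,∞)`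
infinite while a curve of coordinate curvature `≤ C` cannot have length `≫ ε` inside an `ε`-ball).
With the two causality facts already in the tree this makes `HasTrappedZeroEnergyRay` unsatisfiable
on globally hyperbolic holes, hence `ErgoregionBomb` (as typed) true and
`KerrOrBomb = KerrOrBombOfCruxes ZeroEnergyRigidity ErgoregionBomb` a corollary of crux 10690. -/
def AffineRayIsFutureEndless (𝓑 : StationaryAFBlackHole.{0}) [𝓑.metric.HasLeviCivita] : Prop :=
  ∀ γ : ℝ → 𝓑.carrier, IsGeodesicOn 𝓑.metric.leviCivita γ (Set.Ici 0) →
    (∀ s : ℝ, 0 ≤ s → velocity (𝓡 4) γ s ≠ 0) → IsFutureEndless γ (Set.Ici 0)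

/-- **Card `phantom-horizons-have-surface-gravity`, first lemma (schema).** For a vacuum
stationary black hole `𝓑` of the telescope: let `S = {f = 0} ∩ ⟨⟨M_ext⟩⟩` be a `T`-invariant NULL
SHEET — `f` smooth and `T`-invariant, `df = ℓ♭` on `S` with `ℓ` null (so `df ≠ 0`, `S` is a smooth
null hypersurface containing the `T`-direction, its generators `∥ ℓ` are ZERO-ENERGY null geodesics)
— which is COMPACT MODULO THE FLOW (`S ⊆ ⋃ₜ φₜ(K)`, `K` compact in the d.o.c.; after the quotient by
one Killing period `S/ℤ` is a compact smooth null hypersurface of a vacuum spacetime). Then EITHER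
(non-degenerate) there is a Killing field `W` on an open `U ⊇ S`, non-zero and null on `S` — `S` is a
Killing (pre)horizon, `W ∉ ℝT` since `T` is spacelike on `S` — OR (degenerate) every maximal null
geodesic tangent to a generator of `S` is affinely complete (`s = univ`): the isochronous regime
`μ = 1` of card zero-energy-surface-gravity (crux 10691). This is Hawking–Larsson–Minguzzi (totally
geodesic, one-sided completeness) + Hounnonkpe–Minguzzi arXiv:2506.20004 (constant surface gravity,
degenerate OR non-degenerate, any compact totally geodesic null hypersurface under DEC) +
Petersen–Rácz arXiv:1809.02580 Thm 1.2 / Petersen arXiv:1903.09135 (κ ≠ 0 ⇒ Killing field),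
transplanted from compact Cauchy horizons to the ℤ-quotient of a flow-compact null sheet. -/
def PhantomHorizonDichotomy (𝓑 : StationaryAFBlackHole.{0}) [𝓑.metric.HasLeviCivita] : Prop :=
  𝓑.metric.toPseudoRiemannianMetric.IsRicciFlat →
  ∀ (f : 𝓑.carrier → ℝ) (K : Set 𝓑.carrier),
    ContMDiff (𝓡 4) 𝓘(ℝ, ℝ) ((⊤ : ℕ∞) : WithTop ℕ∞) f →
    (∀ x : 𝓑.carrier, mfderiv (𝓡 4) 𝓘(ℝ, ℝ) f x (𝓑.killing x) = 0) →
    IsCompact K → K ⊆ 𝓑.doc →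
    (f ⁻¹' {0} ∩ 𝓑.doc).Nonempty →
    f ⁻¹' {0} ∩ 𝓑.doc ⊆ stationaryOrbit 𝓑.killing K →
    (∀ x ∈ f ⁻¹' {0} ∩ 𝓑.doc, ∃ ℓ : TangentSpace (𝓡 4) x, 𝓑.metric.IsNull ℓ ∧
      ∀ v : TangentSpace (𝓡 4) x, 𝓑.metric.val x ℓ v = mfderiv (𝓡 4) 𝓘(ℝ, ℝ) f x v) →
    (∃ (U : Set 𝓑.carrier) (W : Π x : 𝓑.carrier, TangentSpace (𝓡 4) x),
        IsOpen U ∧ f ⁻¹' {0} ∩ 𝓑.doc ⊆ U ∧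
        𝓑.metric.toPseudoRiemannianMetric.IsKillingFieldOn W U ∧
        ∀ x ∈ f ⁻¹' {0} ∩ 𝓑.doc, W x ≠ 0 ∧ 𝓑.metric.val x (W x) (W x) = 0) ∨
    (∀ (γ : ℝ → 𝓑.carrier) (s : Set ℝ),
        IsMaximalGeodesicOn 𝓑.metric.toPseudoRiemannianMetric.leviCivita γ s →
        (∃ t ∈ s, γ t ∈ f ⁻¹' {0} ∩ 𝓑.doc ∧ ∃ c : ℝ, c ≠ 0 ∧
          ∀ v : TangentSpace (𝓡 4) (γ t),
            𝓑.metric.val (γ t) (velocity (𝓡 4) γ t) v =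
              mfderiv (𝓡 4) 𝓘(ℝ, ℝ) f (γ t) (c • v)) →
        s = Set.univ)

/-- **Sanity (proved): a `T`-invariant null sheet lies in the closed ergoregion and its null
conormal is zero-energy.** If `df(T) = 0` and `df = ℓ♭` with `ℓ` null at `x`, then `g(ℓ, T) = 0`
and `0 ≤ g(T, T)` at `x` (tree lemma `killing_sq_nonneg_of_zeroEnergyNull`): phantom horizons are
objects of the zero-energy optics of the ergoregion belt, never of the `T`-timelike region.
[folklore] -/
theorem phantomSheet_subset_ergoregion (𝓑 : StationaryAFBlackHole.{0}) [𝓑.metric.HasLeviCivita]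
    {f : 𝓑.carrier → ℝ} {x : 𝓑.carrier} {ℓ : TangentSpace (𝓡 4) x}
    (hT : mfderiv (𝓡 4) 𝓘(ℝ, ℝ) f x (𝓑.killing x) = 0) (hℓ : 𝓑.metric.IsNull ℓ)
    (hdf : ∀ v : TangentSpace (𝓡 4) x, 𝓑.metric.val x ℓ v = mfderiv (𝓡 4) 𝓘(ℝ, ℝ) f x v) :
    𝓑.metric.val x ℓ (𝓑.killing x) = 0 ∧ 0 ≤ 𝓑.metric.val x (𝓑.killing x) (𝓑.killing x) := by
  have h0 : 𝓑.metric.val x ℓ (𝓑.killing x) = 0 := by rw [hdf]; exact hT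
  exact ⟨h0, 𝓑.killing_sq_nonneg_of_zeroEnergyNull hℓ.1 hℓ.2 h0⟩

end Summit.FinalStateConjecture.FinalStateConjecture.Cruxes.KerrOrBomb.SketchIdeator1
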